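import Summits.QuantumFields.YangMills.Theses.BalabanLadder
import Summits.QuantumFields.YangMills.Theses.BalabanFamilyExport
import Summits.QuantumFields.YangMills.Theses.BalabanFluctuationExport
import HarnessLib

/-!
# Line `field_regime_split` — Bałaban's small-field/large-field decomposition applied to the conditioning datum
(D-0145 ideator ym-idea-9 g2, LINE 5, lens «complete»)

Skeleton for the crux `Summit.QuantumFields.YangMills.Theses.BalabanLadder.UVSeamRec` (stmt-QuantumFields-20043), realised as the
split of `BalabanFluctuationExport.CondDecoupling` into `SmallFieldDecoupling` (∀δ: block field δ-small near the insertion blocks —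
printed-engine territory), `RoughFieldDecoupling` (∃δ: the complement — the isolated, unprinted energy-spreading principle) and
`SmallEventMeasurable` (support).  The six registered stubs are route items BY NAME; the support item `SmallEventMeasurable` (26274) and the glue
`condDecoupling_of_split : SmallFieldDecoupling → RoughFieldDecoupling → SmallEventMeasurable → CondDecoupling` is PROVED below
(split `Ψ = Ψ·χ_small + Ψ·χ_rough`, integrability from boundedness, constants `max / min`), and `UVSeamRec_of` concludes the crux by name
through `BalabanFluctuationExport.closes`.  No summit, leg or spine crux is proved here; sorries live only inside `stub_*`.
-/

set_option autoImplicit false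

namespace Summit.QuantumFields.YangMills.Cruxes.UVSeamRec.FieldRegimeSplit

open MeasureTheory
open Literature.MathematicalPhysics.QuantumFieldTheory
open Literature.MathematicalPhysics.QuantumFieldTheory.Balaban1983to89
open Literature.MathematicalPhysics.QuantumFieldTheory.Balaban1983to89.T4Continuum
open Literature.MathematicalPhysics.QuantumLattice (LGConfig torusLift fundamentalLatticeRep)
open Summit.QuantumFields.YangMills.Cruxes.OSLegsFromFemtoAndGap.DlrCollarTransfer (plane)
open Summit.QuantumFields.YangMills.Theses.BalabanFluctuationExport

/-- stub (route item, crux rank 3): conditional decoupling for test functions supported on δ-SMALL block fields near the insertions, every δ ∈ (0,1]. -/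
theorem stub_smallFieldDecoupling : SmallFieldDecoupling := by
  sorry

/-- stub (route item, crux rank 2, hardest): conditional decoupling for test functions supported on ROUGH block fields, some δ ∈ (0,1]. -/
theorem stub_roughFieldDecoupling : RoughFieldDecoupling := by
  sorry

/-- stub (route item, crux rank 3 of the parent route): one-point conditional response, sup form. -/
theorem stub_condResponse : CondResponse := by
  sorry

/-- stub (route item, support): the finite subset expansion `CondResponse → CondDecoupling → FamilyCeilings`. -/
theorem stub_fluctuationExportGlue : FluctuationExportGlue := by
  sorry

/-- stub (route item, crux; shared verbatim with BalabanFamilyExport item 25033): the volume seam. -/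
theorem stub_familySeam : FamilySeam := by
  sorry

/-- stub (route item, crux; shared v5(α) engine, item 25034): the floors engine. -/
theorem stub_floorsEngine : FloorsEngine := by
  sorry

/-! ## The support item `SmallEventMeasurable` (route item 26274) — PROVED (no sorry). -/

theorem smallEventMeasurable_holds : SmallEventMeasurable := by
  letI : MeasurableSpace (Matrix.specialUnitaryGroup (Fin 2) ℂ) := borel _
  haveI : BorelSpace (Matrix.specialUnitaryGroup (Fin 2) ℂ) := ⟨rfl⟩
  intro δ F K k hk Q n x cs
  have hav : ∀ j, Measurable (fun U : GaugeField (F.P K) j (Matrix.specialUnitaryGroup (Fin 2) ℂ) =>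
      (BlockAveraging.blockAvg (P := F.P K) (j := j) su2Mean).avg U) :=
    fun j => BlockAveraging.measurable_avgFun (P := F.P K) (j := j) su2Mean measurable_su2Mean_E
  have hiter : ∀ k', Measurable (Averaging.iter (P := F.P K) (G := Matrix.specialUnitaryGroup (Fin 2) ℂ)
      (fun j => BlockAveraging.blockAvg (P := F.P K) (j := j) su2Mean) k') := by
    intro k'
    induction k' with
    | zero => exact measurable_id
    | succ k' ih => exact (hav k').comp ih
  have hof : Measurable (fun V : GaugeConfig 4 ((F.P K).sitesPerDir 0) (Matrix.specialUnitaryGroup (Fin 2) ℂ) =>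
      ofConfig (P := F.P K) (j := 0) V) :=
    measurable_pi_lambda _ fun b => measurable_pi_apply _
  have hQ : Measurable Q := (hiter k).comp hof
  have hpl : ∀ pl : Plaq (F.P K) k, Measurable (fun W : GaugeField (F.P K) k (Matrix.specialUnitaryGroup (Fin 2) ℂ) =>
      dist1 (GaugeField.plaqHol W pl)) := fun pl => by
    have hb : ∀ b : PBond (F.P K) k, Continuous fun U : (PBond (F.P K) k → Matrix.specialUnitaryGroup (Fin 2) ℂ) => U b :=
      fun b => continuous_apply b
    have hc : Continuous fun U : (PBond (F.P K) k → Matrix.specialUnitaryGroup (Fin 2) ℂ) =>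
        GaugeField.plaqHol (P := F.P K) (j := k) U pl := by
      unfold GaugeField.plaqHol
      exact (((hb _).mul (hb _)).mul (hb _).inv).mul (hb _).inv
    have hm : Measurable fun U : (PBond (F.P K) k → Matrix.specialUnitaryGroup (Fin 2) ℂ) =>
        dist1 (GaugeField.plaqHol (P := F.P K) (j := k) U pl) :=
      RegularGaugeGroup.measurable_dist1.comp hc.measurable
    exact hm
  have hS : MeasurableSet {W : GaugeField (F.P K) k (Matrix.specialUnitaryGroup (Fin 2) ℂ) |
      PlaqSmallOn {pl : Plaq (F.P K) k | ∃ i, Site.tdist pl.src (cs i) ≤ 2} δ W} := by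
    have : {W : GaugeField (F.P K) k (Matrix.specialUnitaryGroup (Fin 2) ℂ) |
        PlaqSmallOn {pl : Plaq (F.P K) k | ∃ i, Site.tdist pl.src (cs i) ≤ 2} δ W}
        = ⋂ pl ∈ {pl : Plaq (F.P K) k | ∃ i, Site.tdist pl.src (cs i) ≤ 2},
            {W | dist1 (GaugeField.plaqHol W pl) < δ} := by
      ext W; simp only [PlaqSmallOn, Set.mem_setOf_eq, Set.mem_iInter]
    rw [this]
    exact MeasurableSet.biInter (Set.to_countable _) fun pl _ => measurableSet_lt (hpl pl) measurable_const
  exact hQ hS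

/-! ## The glue of the split (route item 26275 `CondDecouplingGlue`) — PROVED (no sorry). -/

/-- The parent crux `BalabanFluctuationExport.CondDecoupling` (item 26017) with its `let`s expanded (definitionally equal — the final coercion
`condDecoupling_of_split` is the identity); the tactic proof of the glue runs against this form so that `intro` names line up. -/
def CondDecouplingX : Prop :=
  letI : MeasurableSpace (Matrix.specialUnitaryGroup (Fin 2) ℂ) := borel _
  haveI : BorelSpace (Matrix.specialUnitaryGroup (Fin 2) ℂ) := ⟨rfl⟩
  ∀ L : ℕ, Odd L → 11 < L →
  ∃ (C β₄ ℓ₄ : ℝ), 0 < ℓ₄ ∧ 0 ≤ C ∧ ∀ β : ℝ, β₄ ≤ β →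
    ∀ (F : T4Family) (K k : ℕ), F.L = L → k + 1 ≤ F.m + K →
      ((L : ℝ) ^ k) * Summit.QuantumFields.YangMills.Cruxes.UVSeamRec.Transport.uRec β ≤ ℓ₄ →
      haveI : NeZero ((F.P K).sitesPerDir 0) := ⟨Params.sitesPerDir_ne_zero _ _⟩
      ∀ (n : ℕ) (q : Fin n → Fin 4 × Fin 4) (x : Fin n → (Fin 4 → ℤ)), (∀ i, (q i).1 < (q i).2) →
        (∀ i j : Fin n, i ≠ j → ∃ κ : Fin 4,
          (2 * ((L : ℤ) ^ k) + 4) ≤ |((((x i κ - x j κ : ℤ) : ZMod ((F.P K).sitesPerDir 0))).valMinAbs : ℤ)|) →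
        ∀ g : Fin n → (GaugeField (F.P K) k (Matrix.specialUnitaryGroup (Fin 2) ℂ) → ℝ),
          (∃ D : ℝ, ∀ i W, |g i W| ≤ D) →
          (∀ i, Measurable (fun V : GaugeConfig 4 ((F.P K).sitesPerDir 0) (Matrix.specialUnitaryGroup (Fin 2) ℂ) =>
              g i (Averaging.iter (fun j => BlockAveraging.blockAvg (P := F.P K) (j := j) su2Mean) k
                (ofConfig (P := F.P K) (j := 0) V)))) →
          (∀ i, ∀ φ : GaugeField (F.P K) k (Matrix.specialUnitaryGroup (Fin 2) ℂ) → ℝ,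
            Measurable (fun V : GaugeConfig 4 ((F.P K).sitesPerDir 0) (Matrix.specialUnitaryGroup (Fin 2) ℂ) =>
              φ (Averaging.iter (fun j => BlockAveraging.blockAvg (P := F.P K) (j := j) su2Mean) k
                (ofConfig (P := F.P K) (j := 0) V))) →
            (∀ W, |φ W| ≤ 1) →
            ∫ V, (plane (Matrix.specialUnitaryGroup (Fin 2) ℂ) (fundamentalLatticeRep 2) (q i) (x i)
                    (torusLift ((F.P K).sitesPerDir 0) V)
                  - g i (Averaging.iter (fun j => BlockAveraging.blockAvg (P := F.P K) (j := j) su2Mean) k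
                      (ofConfig (P := F.P K) (j := 0) V)))
                * φ (Averaging.iter (fun j => BlockAveraging.blockAvg (P := F.P K) (j := j) su2Mean) k
                      (ofConfig (P := F.P K) (j := 0) V))
              ∂(wilsonMeasure (d := 4) (L := (F.P K).sitesPerDir 0) (fundamentalLatticeRep 2).ρ β) = 0) →
        ∀ Ψ : GaugeField (F.P K) k (Matrix.specialUnitaryGroup (Fin 2) ℂ) → ℝ,
          Measurable (fun V : GaugeConfig 4 ((F.P K).sitesPerDir 0) (Matrix.specialUnitaryGroup (Fin 2) ℂ) =>
              Ψ (Averaging.iter (fun j => BlockAveraging.blockAvg (P := F.P K) (j := j) su2Mean) k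
                (ofConfig (P := F.P K) (j := 0) V))) →
          (∀ W, |Ψ W| ≤ 1) →
          |∫ V, (∏ i, (plane (Matrix.specialUnitaryGroup (Fin 2) ℂ) (fundamentalLatticeRep 2) (q i) (x i)
                    (torusLift ((F.P K).sitesPerDir 0) V)
                  - g i (Averaging.iter (fun j => BlockAveraging.blockAvg (P := F.P K) (j := j) su2Mean) k
                      (ofConfig (P := F.P K) (j := 0) V))))
                * Ψ (Averaging.iter (fun j => BlockAveraging.blockAvg (P := F.P K) (j := j) su2Mean) k
                      (ofConfig (P := F.P K) (j := 0) V))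
              ∂(wilsonMeasure (d := 4) (L := (F.P K).sitesPerDir 0) (fundamentalLatticeRep 2).ρ β)|
            ≤ (C / ((L : ℝ) ^ k) ^ 4) ^ n *
              ∫ V, |Ψ (Averaging.iter (fun j => BlockAveraging.blockAvg (P := F.P K) (j := j) su2Mean) k
                      (ofConfig (P := F.P K) (j := 0) V))|
                ∂(wilsonMeasure (d := 4) (L := (F.P K).sitesPerDir 0) (fundamentalLatticeRep 2).ρ β)

attribute [local instance] Classical.propDecidable in
theorem condDecoupling_of_splitX :
    SmallFieldDecoupling → RoughFieldDecoupling → SmallEventMeasurable → CondDecouplingX := by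
  intro hS hR hM
  letI : MeasurableSpace (Matrix.specialUnitaryGroup (Fin 2) ℂ) := borel _
  haveI : BorelSpace (Matrix.specialUnitaryGroup (Fin 2) ℂ) := ⟨rfl⟩
  intro L hLo hL11
  obtain ⟨δ, hδ0, hδ1, C₂, β₂, ℓ₂, hℓ₂, hC₂, hRough⟩ := hR L hLo hL11
  obtain ⟨C₁, β₁, ℓ₁, hℓ₁, hC₁, hSmall⟩ := hS L hLo hL11 δ hδ0 hδ1
  refine ⟨max C₁ C₂, max β₁ β₂, min ℓ₁ ℓ₂, lt_min hℓ₁ hℓ₂, le_max_of_le_left hC₁, ?_⟩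
  intro β hβ F K k hFL hk hb n q x hq hsep g hgb hgm horth Ψ hΨm hΨb
  haveI : NeZero ((F.P K).sitesPerDir 0) := ⟨Params.sitesPerDir_ne_zero _ _⟩
  -- abbreviations
  set M : ℕ := (F.P K).sitesPerDir 0 with hMdef
  set Q : GaugeConfig 4 M (Matrix.specialUnitaryGroup (Fin 2) ℂ) →
      GaugeField (F.P K) k (Matrix.specialUnitaryGroup (Fin 2) ℂ) :=
    fun V => Averaging.iter (fun j => BlockAveraging.blockAvg (P := F.P K) (j := j) su2Mean) k
      (ofConfig (P := F.P K) (j := 0) V) with hQdef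
  set μ : Measure (GaugeConfig 4 M (Matrix.specialUnitaryGroup (Fin 2) ℂ)) :=
    wilsonMeasure (d := 4) (L := M) (fundamentalLatticeRep 2).ρ β with hμdef
  set T : GaugeConfig 4 M (Matrix.specialUnitaryGroup (Fin 2) ℂ) → ℝ :=
    fun V => ∏ i, (plane (Matrix.specialUnitaryGroup (Fin 2) ℂ) (fundamentalLatticeRep 2) (q i) (x i) (torusLift M V)
      - g i (Q V)) with hTdef
  let cs : Fin n → Site (F.P K) k :=
    fun i ν => (((((x i ν : ℤ) : ZMod ((F.P K).sitesPerDir 0))).val / F.L ^ k : ℕ) : ZMod ((F.P K).sitesPerDir k))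
  let Sm : GaugeField (F.P K) k (Matrix.specialUnitaryGroup (Fin 2) ℂ) → Prop :=
    fun W => PlaqSmallOn {pl : Plaq (F.P K) k | ∃ i, Site.tdist pl.src (cs i) ≤ 2} δ W
  let Ψs : GaugeField (F.P K) k (Matrix.specialUnitaryGroup (Fin 2) ℂ) → ℝ := fun W => if Sm W then Ψ W else 0
  let Ψr : GaugeField (F.P K) k (Matrix.specialUnitaryGroup (Fin 2) ℂ) → ℝ := fun W => if Sm W then 0 else Ψ W
  -- measurability of the small-field event and of the two pieces
  have hSm : MeasurableSet {V : GaugeConfig 4 M (Matrix.specialUnitaryGroup (Fin 2) ℂ) | Sm (Q V)} := hM δ F K k hk n x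
  have hΨsm : Measurable (fun V => Ψs (Q V)) := Measurable.ite hSm hΨm measurable_const
  have hΨrm : Measurable (fun V => Ψr (Q V)) := Measurable.ite hSm measurable_const hΨm
  have hΨsb : ∀ W, |Ψs W| ≤ 1 := fun W => by
    by_cases h : Sm W <;> simp [Ψs, h, hΨb W]
  have hΨrb : ∀ W, |Ψr W| ≤ 1 := fun W => by
    by_cases h : Sm W <;> simp [Ψr, h, hΨb W]
  have hΨss : ∀ W, ¬ Sm W → Ψs W = 0 := fun W h => by simp [Ψs, h]
  have hΨrs : ∀ W, Sm W → Ψr W = 0 := fun W h => by simp [Ψr, h]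
  -- the two halves
  have hb₁ : ((L : ℝ) ^ k) * Summit.QuantumFields.YangMills.Cruxes.UVSeamRec.Transport.uRec β ≤ ℓ₁ := hb.trans (min_le_left _ _)
  have hb₂ : ((L : ℝ) ^ k) * Summit.QuantumFields.YangMills.Cruxes.UVSeamRec.Transport.uRec β ≤ ℓ₂ := hb.trans (min_le_right _ _)
  have h1 : |∫ V, T V * Ψs (Q V) ∂μ| ≤ (C₁ / ((L : ℝ) ^ k) ^ 4) ^ n * ∫ V, |Ψs (Q V)| ∂μ :=
    hSmall β ((le_max_left _ _).trans hβ) F K k hFL hk hb₁ n q x hq hsep g hgb hgm horth Ψs hΨsm hΨsb hΨss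
  have h2 : |∫ V, T V * Ψr (Q V) ∂μ| ≤ (C₂ / ((L : ℝ) ^ k) ^ 4) ^ n * ∫ V, |Ψr (Q V)| ∂μ :=
    hRough β ((le_max_right _ _).trans hβ) F K k hFL hk hb₂ n q x hq hsep g hgb hgm horth Ψr hΨrm hΨrb hΨrs
  -- integrability bookkeeping
  haveI : IsProbabilityMeasure μ :=
    isProbabilityMeasure_wilsonMeasure (d := 4) (L := M) (fundamentalLatticeRep 2).ρ (fundamentalLatticeRep 2).continuous β
  obtain ⟨D, hD⟩ := hgb
  obtain ⟨B, hB⟩ := Summit.QuantumFields.YangMills.Cruxes.OSLegsFromFemtoAndGap.DlrCollarTransfer.exists_abs_plane_le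
    (G := Matrix.specialUnitaryGroup (Fin 2) ℂ) (fundamentalLatticeRep 2)
  have hTm : Measurable T := by
    refine Finset.measurable_prod _ fun i _ => ?_
    exact ((Summit.QuantumFields.YangMills.Cruxes.OSLegsFromFemtoAndGap.DlrCollarTransfer.continuous_plane
      (G := Matrix.specialUnitaryGroup (Fin 2) ℂ) (fundamentalLatticeRep 2) (q i) (x i)).measurable.comp
      (measurable_torusLift (d := 4) (G := Matrix.specialUnitaryGroup (Fin 2) ℂ) M)).sub (hgm i)
  have hTb : ∀ V, |T V| ≤ (B + D) ^ n := fun V => by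
    simp only [hTdef, Finset.abs_prod]
    calc ∏ i, |plane (Matrix.specialUnitaryGroup (Fin 2) ℂ) (fundamentalLatticeRep 2) (q i) (x i) (torusLift M V) - g i (Q V)|
        ≤ ∏ _i : Fin n, (B + D) := Finset.prod_le_prod (fun i _ => abs_nonneg _) fun i _ =>
            (abs_sub _ _).trans (add_le_add (hB _ _ _) (hD _ _))
      _ = (B + D) ^ n := by simp
  have hint : ∀ χ : GaugeField (F.P K) k (Matrix.specialUnitaryGroup (Fin 2) ℂ) → ℝ,
      Measurable (fun V => χ (Q V)) → (∀ W, |χ W| ≤ 1) → Integrable (fun V => T V * χ (Q V)) μ := fun χ hχm hχb => by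
    refine Integrable.mono' (integrable_const ((B + D) ^ n * 1)) (hTm.mul hχm).aestronglyMeasurable
      (Filter.Eventually.of_forall fun V => ?_)
    rw [Real.norm_eq_abs, abs_mul]
    exact mul_le_mul (hTb V) (hχb _) (abs_nonneg _) ((abs_nonneg _).trans (hTb V))
  have hintabs : ∀ χ : GaugeField (F.P K) k (Matrix.specialUnitaryGroup (Fin 2) ℂ) → ℝ,
      Measurable (fun V => χ (Q V)) → (∀ W, |χ W| ≤ 1) → Integrable (fun V => |χ (Q V)|) μ := fun χ hχm hχb => by
    refine Integrable.mono' (integrable_const (1 : ℝ)) hχm.abs.aestronglyMeasurable (Filter.Eventually.of_forall fun V => ?_)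
    rw [Real.norm_eq_abs, abs_abs]; exact hχb _
  -- pointwise splitting
  have hsplit : ∀ V, T V * Ψ (Q V) = T V * Ψs (Q V) + T V * Ψr (Q V) := fun V => by
    by_cases h : Sm (Q V) <;> simp [Ψs, Ψr, h]
  have habs : ∀ V, |Ψ (Q V)| = |Ψs (Q V)| + |Ψr (Q V)| := fun V => by
    by_cases h : Sm (Q V) <;> simp [Ψs, Ψr, h]
  have hI : ∫ V, T V * Ψ (Q V) ∂μ = ∫ V, T V * Ψs (Q V) ∂μ + ∫ V, T V * Ψr (Q V) ∂μ := by
    rw [← integral_add (hint Ψs hΨsm hΨsb) (hint Ψr hΨrm hΨrb)]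
    exact integral_congr_ae (Filter.Eventually.of_forall hsplit)
  have hIabs : ∫ V, |Ψ (Q V)| ∂μ = ∫ V, |Ψs (Q V)| ∂μ + ∫ V, |Ψr (Q V)| ∂μ := by
    rw [← integral_add (hintabs Ψs hΨsm hΨsb) (hintabs Ψr hΨrm hΨrb)]
    exact integral_congr_ae (Filter.Eventually.of_forall habs)
  -- constants
  have hLpos : (0 : ℝ) < ((L : ℝ) ^ k) ^ 4 := by positivity
  have hq₁ : (C₁ / ((L : ℝ) ^ k) ^ 4) ^ n ≤ (max C₁ C₂ / ((L : ℝ) ^ k) ^ 4) ^ n :=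
    pow_le_pow_left₀ (div_nonneg hC₁ hLpos.le) (div_le_div_of_nonneg_right (le_max_left _ _) hLpos.le) n
  have hq₂ : (C₂ / ((L : ℝ) ^ k) ^ 4) ^ n ≤ (max C₁ C₂ / ((L : ℝ) ^ k) ^ 4) ^ n :=
    pow_le_pow_left₀ (div_nonneg hC₂ hLpos.le) (div_le_div_of_nonneg_right (le_max_right _ _) hLpos.le) n
  have hIs : 0 ≤ ∫ V, |Ψs (Q V)| ∂μ := integral_nonneg fun V => abs_nonneg _
  have hIr : 0 ≤ ∫ V, |Ψr (Q V)| ∂μ := integral_nonneg fun V => abs_nonneg _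
  -- conclusion
  show |∫ V, T V * Ψ (Q V) ∂μ| ≤ (max C₁ C₂ / ((L : ℝ) ^ k) ^ 4) ^ n * ∫ V, |Ψ (Q V)| ∂μ
  rw [hI, hIabs, mul_add]
  calc |∫ V, T V * Ψs (Q V) ∂μ + ∫ V, T V * Ψr (Q V) ∂μ|
      ≤ |∫ V, T V * Ψs (Q V) ∂μ| + |∫ V, T V * Ψr (Q V) ∂μ| := abs_add_le _ _
    _ ≤ (C₁ / ((L : ℝ) ^ k) ^ 4) ^ n * ∫ V, |Ψs (Q V)| ∂μ + (C₂ / ((L : ℝ) ^ k) ^ 4) ^ n * ∫ V, |Ψr (Q V)| ∂μ :=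
        add_le_add h1 h2
    _ ≤ (max C₁ C₂ / ((L : ℝ) ^ k) ^ 4) ^ n * ∫ V, |Ψs (Q V)| ∂μ
        + (max C₁ C₂ / ((L : ℝ) ^ k) ^ 4) ^ n * ∫ V, |Ψr (Q V)| ∂μ :=
        add_le_add (mul_le_mul_of_nonneg_right hq₁ hIs) (mul_le_mul_of_nonneg_right hq₂ hIr)

/-- The glue of the split over the ROUTE decls (item 26275 `CondDecouplingGlue`): `CondDecouplingX` and `CondDecoupling` are definitionally
equal (`let`-expansion), so this is the previous theorem. -/
theorem condDecoupling_of_split :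
    SmallFieldDecoupling → RoughFieldDecoupling → SmallEventMeasurable → CondDecoupling :=
  condDecoupling_of_splitX

/-- … and it is literally the route's glue item. -/
theorem condDecouplingGlue_holds : CondDecouplingGlue := condDecoupling_of_split

/-- The composition: the six stubs give the spine crux BY NAME (kernel-checked, no sorry outside the stubs). -/
theorem UVSeamRec_of :
    SmallFieldDecoupling → RoughFieldDecoupling → CondResponse → FluctuationExportGlue →
      FamilySeam → FloorsEngine → Summit.QuantumFields.YangMills.Theses.BalabanLadder.UVSeamRec :=
  fun hS hR h₁ h₃ h₄ h₅ =>
    Summit.QuantumFields.YangMills.Theses.BalabanFluctuationExport.closes h₁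
      (condDecoupling_of_split hS hR smallEventMeasurable_holds) h₃ h₄ h₅

theorem UVSeamRec_holds_of_stubs : Summit.QuantumFields.YangMills.Theses.BalabanLadder.UVSeamRec :=
  UVSeamRec_of stub_smallFieldDecoupling stub_roughFieldDecoupling stub_condResponse
    stub_fluctuationExportGlue stub_familySeam stub_floorsEngine

end Summit.QuantumFields.YangMills.Cruxes.UVSeamRec.FieldRegimeSplit
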